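import Summits.QuantumAdvantage.AdviceFreeQNC0.AffineStakesMoves
import HarnessLib

/-!
# Cell qa-qnc0 — RUNG `AffineStakesHardOdd3` PROVED (planner qa-qnc0-p1 g19, ROUND-18 §3.6;
`exp19/Sketch19.lean` §6)

`affineStakesHardOdd3 : AffineStakesHardOdd3`: there is an absolute `θ < 1` such that for every `c`, all
large `n`, every read matrix `A` with rows of weight `≤ (log₂ n)^c` and every constant vector `cv`, the
`𝔽₂`-affine stake strategy `z_j = t_j(x) ⊕ cv_j ⊕ ⊕_{i : A j i} x_i` satisfies the ring relation on at most
`θ·2^{n-1}` odd patterns — the first DENSE class with unbounded read multiplicity and arbitrary far reads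
for which `θ < 1` is a tree theorem (a literal sub-case of the conclusion `RingHardOdd 3` of crux 22907).

Proof (ROUND-18 §3.6, "gauge rigidity"), assembling the landed pieces:
(1) FAR DISAGREEMENT — some bell `k` reads two coins `p, p'` far from each other and from `k` differently:
    the coin-pair flip at `p, p'` changes the win bit by `|supp J ∩ T_{pp'}| mod 2` (`win_flipPair_affine`),
    which is odd on `≥ c₁·2^{n-1}` odd patterns with particles at `p, p'` (`hardcoreToggle`); loss ≥ ½·
    influence (`card_win_le_of_changed`);
(3) otherwise the read matrix has RADIUS 1 (`isRadiusOne_of_not_far`, weight bound);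
(4a) `κ` not constant: coin-pair flip at two particles with different `κ` (`coinPair_flips`) on the
    cylinder `{J_a = J_b = 0}` (`hardcoreCylinderLB`);
(4b)/(4c) `κ ≡ 1`, or `κ ≡ 0` with some `e_s = 1`: the creation move at `s` on a 5-site cylinder
    (`creation_flips`);
(4d) `κ ≡ 0`, `e ≡ 0`: the NULL family never wins (`wval_null`).
`θ = 1 - η/2`, `η = min(c₀, c₁, 1)`.

WHAT THIS IS NOT: nothing about non-affine stakes; crux 22907 (`RingDenseResidualLt3`, all polylog-degree
`𝔽₃` strategies) untouched; separation NOT moved.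
-/

namespace Summit.QuantumAdvantage.AdviceFreeQNC0.Fib19

open Finset Literature.Computability.QuantumComplexity Literature.Computability.QuantumComplexity.RingHLF

variable {n : ℕ}

/-- A two-point flip is injective on any set. -/
theorem flipAt_injOn (S : Finset (Fin n)) (D : Finset (Fin n → Bool)) :
    Set.InjOn (fun x : Fin n → Bool => flipAt x S) ↑D := by
  intro x _ y _ h
  have h' := congrArg (fun w : Fin n → Bool => flipAt w S) h
  simpa only [flipAt_flipAt] using h'

/-- **RUNG `AffineStakesHardOdd3` from the cylinder bound** (Sketch19 §6 `affineStakesHardOdd3_of`):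
ROUND-18 §3.6 steps (1)–(4). -/
theorem affineStakesHardOdd3_of (hC : HardcoreCylinderLB) : AffineStakesHardOdd3 := by
  obtain ⟨c₁, hc₁, n₂, htog⟩ := hardcoreToggle_of hC
  obtain ⟨c₀, hc₀, n₁, hcyl⟩ := hC
  set η : ℝ := min (min c₀ c₁) 1 with hη
  have hη0 : 0 < η := lt_min (lt_min hc₀ hc₁) one_pos
  have hηc₀ : η ≤ c₀ := (min_le_left _ _).trans (min_le_left _ _)
  have hηc₁ : η ≤ c₁ := (min_le_left _ _).trans (min_le_right _ _)
  have hη1 : η ≤ 1 := min_le_right _ _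
  refine ⟨1 - η / 2, by linarith, fun c => ?_⟩
  obtain ⟨n₃, hlog⟩ := logPow_add_four_le c
  refine ⟨max (max n₁ n₂) (max n₃ 10), fun n hn A cv hw => ?_⟩
  have hn₁ : n₁ ≤ n := le_trans (le_trans (le_max_left _ _) (le_max_left _ _)) hn
  have hn₂ : n₂ ≤ n := le_trans (le_trans (le_max_right _ _) (le_max_left _ _)) hn
  have hn₃ : n₃ ≤ n := le_trans (le_trans (le_max_left _ _) (le_max_right _ _)) hn
  have hn10 : 10 ≤ n := le_trans (le_trans (le_max_right _ _) (le_max_right _ _)) hn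
  have hn3 : 3 ≤ n := by omega
  have hpow : (0 : ℝ) < (2 : ℝ) ^ (n - 1) := by positivity
  set WIN := univ.filter fun x : Fin n → Bool => IsOdd x ∧ Rel x (affineStrategy A cv x) with hWIN
  -- reduction to: WIN is empty, or some move changes the win bit on a set of η-measure
  suffices key : WIN.card = 0 ∨ ∃ D : Finset (Fin n → Bool),
      η * (2 : ℝ) ^ (n - 1) ≤ (D.card : ℝ) ∧ 2 * WIN.card + D.card ≤ 2 * 2 ^ (n - 1) by
    have hfin : (WIN.card : ℝ) ≤ (1 - η / 2) * (2 : ℝ) ^ (n - 1) := by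
      rcases key with h0 | ⟨D, hD1, hD2⟩
      · rw [h0, Nat.cast_zero]
        have : 0 ≤ 1 - η / 2 := by linarith
        positivity
      · have h2 := (Nat.cast_le (α := ℝ)).2 hD2
        rw [Nat.cast_add, Nat.cast_mul, Nat.cast_mul, Nat.cast_pow, Nat.cast_ofNat] at h2
        linarith
    refine le_trans ?_ hfin
    -- the statement's set is `WIN`
    refine (Nat.cast_le (α := ℝ)).2 (card_le_card fun x hx => ?_)
    simp only [mem_filter, mem_univ, true_and] at hx
    rw [hWIN, mem_filter]
    exact ⟨mem_univ _, (isOdd_iff_oddZeros x).2 hx.1, hx.2⟩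
  -- a move changing the win bit on a cylinder-size set gives the second alternative
  have move : ∀ (D : Finset (Fin n → Bool)) (M : (Fin n → Bool) → (Fin n → Bool)) (cst : ℝ),
      η ≤ cst → cst * (2 : ℝ) ^ (n - 1) ≤ (D.card : ℝ) →
      (∀ x ∈ D, IsOdd x ∧ IsOdd (M x)) → Set.InjOn M ↑D →
      (∀ x ∈ D, ¬ (Rel x (affineStrategy A cv x) ↔ Rel (M x) (affineStrategy A cv (M x)))) →
      WIN.card = 0 ∨ ∃ D : Finset (Fin n → Bool),
        η * (2 : ℝ) ^ (n - 1) ≤ (D.card : ℝ) ∧ 2 * WIN.card + D.card ≤ 2 * 2 ^ (n - 1) := by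
    intro D M cst hcst hD0 hD hinj hch
    refine Or.inr ⟨D, le_trans (by gcongr) hD0, ?_⟩
    exact card_win_le_of_changed (by omega) (affineStrategy A cv) M D hD hinj hch
  by_cases hfar : ∃ p p' k : Fin n, p' ≠ prv p ∧ p' ≠ p ∧ p' ≠ nxt p ∧ k ≠ prv p ∧ k ≠ p ∧ k ≠ nxt p ∧
      k ≠ prv p' ∧ k ≠ p' ∧ k ≠ nxt p' ∧ A k p ≠ A k p'
  · /- (1) FAR DISAGREEMENT: the toggle lemma + the coin-pair identity -/
    obtain ⟨p, p', k, e1, e2, e3, e4, e5, e6, e7, e8, e9, hA⟩ := hfar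
    set T : Finset (Fin n) := univ.filter fun j : Fin n => A j p ≠ A j p' with hT
    have hkT : k ∈ T := mem_filter.2 ⟨mem_univ _, hA⟩
    have d1 : 2 ≤ (p'.val + n - p.val) % n := two_le_dist_of_ne e2 e3
    have d2 : 2 ≤ (p.val + n - p'.val) % n :=
      two_le_dist_of_ne (Ne.symm e2) fun h => e1 (by rw [h, prv_nxt])
    have d3 : 2 ≤ (k.val + n - p.val) % n := two_le_dist_of_ne e5 e6
    have d4 : 2 ≤ (p.val + n - k.val) % n :=
      two_le_dist_of_ne (Ne.symm e5) fun h => e4 (by rw [h, prv_nxt])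
    have d5 : 2 ≤ (k.val + n - p'.val) % n := two_le_dist_of_ne e8 e9
    have d6 : 2 ≤ (p'.val + n - k.val) % n :=
      two_le_dist_of_ne (Ne.symm e8) fun h => e7 (by rw [h, prv_nxt])
    have htog' := htog n hn₂ p p' k T d1 d2 d3 d4 d5 d6 hkT 1 one_lt_two
    set D : Finset (Fin n → Bool) := univ.filter fun x : Fin n → Bool => IsOdd x ∧ kline x p = false ∧
      kline x p' = false ∧ (T.filter fun j => kline x j = true).card % 2 = 1 with hD
    refine move D (fun x => flipAt x {p, p'}) c₁ hηc₁ ?_ ?_ (flipAt_injOn _ _) ?_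
    · refine le_trans htog' ((Nat.cast_le (α := ℝ)).2 (card_le_card fun x hx => ?_))
      simp only [mem_filter, mem_univ, true_and] at hx
      rw [hD, mem_filter]
      exact ⟨mem_univ _, (isOdd_iff_oddZeros x).2 hx.1, hx.2⟩
    · intro x hx
      rw [hD, mem_filter] at hx
      obtain ⟨-, ho, hp, hp', -⟩ := hx
      exact ⟨ho, (kline_flipPair hn3 x ho (Ne.symm e2) hp hp').1⟩
    · intro x hx
      rw [hD, mem_filter] at hx
      obtain ⟨-, ho, hp, hp', hpar⟩ := hx
      have h := win_flipPair_affine hn3 A cv x ho (Ne.symm e2) hp hp'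
      have hset : (univ.filter fun j : Fin n => kline x j = true ∧ A j p ≠ A j p') =
          T.filter fun j => kline x j = true := by
        rw [hT, filter_filter]
        exact filter_congr fun j _ => and_comm
      rw [hset, hpar] at h
      have h' : ¬ (Rel (flipAt x {p, p'}) (affineStrategy A cv (flipAt x {p, p'})) ↔
          Rel x (affineStrategy A cv x)) := by simpa using h
      exact fun e => h' e.symm
  · /- (3) RADIUS 1 -/
    have hR : IsRadiusOne A := isRadiusOne_of_not_far hn10 A c hw (hlog n hn₃) hfar
    -- the creation move (steps 4b, 4c), given a position `s` and the fifth value `b₀`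
    have hcreate : ∀ (s : Fin n) (b₀ : Bool),
        eps A cv s + kap A (prv s) + bitVal b₀ * kap A (nxt s) = 1 →
        WIN.card = 0 ∨ ∃ D : Finset (Fin n → Bool),
          η * (2 : ℝ) ^ (n - 1) ≤ (D.card : ℝ) ∧ 2 * WIN.card + D.card ≤ 2 * 2 ^ (n - 1) := by
      intro s b₀ hΔ
      have d1 : nxt (nxt (nxt s)) ≠ nxt (nxt s) := nxt_ne_self (by omega) _
      have d2 : (nxt^[2]) s ≠ s := nxt_iterate_ne_self s (by norm_num) (by omega)
      have d3 : (nxt^[3]) s ≠ s := nxt_iterate_ne_self s (by norm_num) (by omega)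
      have d4 : (nxt^[4]) s ≠ s := nxt_iterate_ne_self s (by norm_num) (by omega)
      have ds : s ≠ nxt (nxt s) := fun e => d2 e.symm
      have dns : nxt s ≠ nxt (nxt s) := (nxt_ne_self (by omega) (nxt s)).symm
      have dps : prv s ≠ nxt (nxt s) := fun e => d3 (by
        rw [show (nxt^[3]) s = nxt (nxt (nxt s)) from rfl, ← e, nxt_prv])
      have dpps : prv (prv s) ≠ nxt (nxt s) := fun e => d4 (by
        rw [show (nxt^[4]) s = nxt (nxt (nxt (nxt s))) from rfl, ← e, nxt_prv, nxt_prv])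
      set σ : Fin n → Bool := fun i => if i = nxt (nxt s) then b₀ else true with hσ
      set S : Finset (Fin n) := {prv (prv s), prv s, s, nxt s, nxt (nxt s)} with hS
      have hS7 : S.card ≤ 7 := card_le_five.trans (by norm_num)
      have hσS : ∀ i ∈ S, nxt i ∈ S → ¬ (σ i = false ∧ σ (nxt i) = false) := by
        rintro i - - ⟨hi, hni⟩
        have h1 : i = nxt (nxt s) := by
          by_contra hne; simp only [hσ, hne, if_false] at hi; exact Bool.noConfusion hi
        have h2 : nxt i = nxt (nxt s) := by
          by_contra hne; simp only [hσ, hne, if_false] at hni; exact Bool.noConfusion hni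
        rw [h1] at h2
        exact d1 h2
      have hcyl' := hcyl n hn₁ S hS7 σ hσS
      set D : Finset (Fin n → Bool) := univ.filter fun x : Fin n → Bool => IsOdd x ∧
        kline x (prv (prv s)) = true ∧ kline x (prv s) = true ∧ kline x s = true ∧ kline x (nxt s) = true ∧
        kline x (nxt (nxt s)) = b₀ with hD
      refine move D (fun x => flipAt x {prv s, nxt s}) c₀ hηc₀ ?_ ?_ (flipAt_injOn _ _) ?_
      · refine le_trans hcyl' ((Nat.cast_le (α := ℝ)).2 (card_le_card fun x hx => ?_))
        simp only [mem_filter, mem_univ, true_and] at hx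
        obtain ⟨ho, hk⟩ := hx
        rw [hD, mem_filter]
        have k1 := hk (prv (prv s)) (by simp [hS])
        have k2 := hk (prv s) (by simp [hS])
        have k3 := hk s (by simp [hS])
        have k4 := hk (nxt s) (by simp [hS])
        have k5 := hk (nxt (nxt s)) (by simp [hS])
        simp only [hσ, dpps, dps, ds, dns, if_false, if_true] at k1 k2 k3 k4 k5
        exact ⟨mem_univ _, (isOdd_iff_oddZeros x).2 ho, k1, k2, k3, k4, k5⟩
      · intro x hx
        rw [hD, mem_filter] at hx
        obtain ⟨-, ho, k1, k2, k3, k4, k5⟩ := hx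
        exact ⟨ho, (creation_flips (by omega) hR cv s b₀ hΔ x ho k1 k2 k3 k4 k5).1⟩
      · intro x hx
        rw [hD, mem_filter] at hx
        obtain ⟨-, ho, k1, k2, k3, k4, k5⟩ := hx
        exact (creation_flips (by omega) hR cv s b₀ hΔ x ho k1 k2 k3 k4 k5).2
    by_cases hκ : ∃ q, kap A (nxt q) ≠ kap A q
    · /- (4a) κ NOT CONSTANT: coin-pair flip at two particles with different κ -/
      obtain ⟨q, hq⟩ := hκ
      obtain ⟨a, b, f1, f2, f3, hab⟩ := exists_far_pair_of_kap_ne (by omega) A hq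
      have hna : nxt a ≠ a := nxt_ne_self (by omega) a
      have hnb : nxt b ≠ b := nxt_ne_self (by omega) b
      set S : Finset (Fin n) := {a, b} with hS
      have hS7 : S.card ≤ 7 := card_le_two.trans (by norm_num)
      have hσS : ∀ i ∈ S, nxt i ∈ S → ¬ ((fun _ : Fin n => false) i = false ∧
          (fun _ : Fin n => false) (nxt i) = false) := by
        intro i hi hni _
        simp only [hS, mem_insert, mem_singleton] at hi hni
        rcases hi with rfl | rfl
        · rcases hni with h | h
          · exact hna h
          · exact f3 h.symm
        · rcases hni with h | h
          · exact f1 (nxt_eq_iff.1 h)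
          · exact hnb h
      have hcyl' := hcyl n hn₁ S hS7 (fun _ => false) hσS
      set D : Finset (Fin n → Bool) := univ.filter fun x : Fin n → Bool => IsOdd x ∧
        kline x a = false ∧ kline x b = false with hD
      refine move D (fun x => flipAt x {a, b}) c₀ hηc₀ ?_ ?_ (flipAt_injOn _ _) ?_
      · refine le_trans hcyl' ((Nat.cast_le (α := ℝ)).2 (card_le_card fun x hx => ?_))
        simp only [mem_filter, mem_univ, true_and] at hx
        obtain ⟨ho, hk⟩ := hx
        rw [hD, mem_filter]
        exact ⟨mem_univ _, (isOdd_iff_oddZeros x).2 ho, hk a (by simp [hS]), hk b (by simp [hS])⟩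
      · intro x hx
        rw [hD, mem_filter] at hx
        obtain ⟨-, ho, ha, hb⟩ := hx
        exact ⟨ho, (coinPair_flips hn3 hR cv (Ne.symm f2) hab x ho ha hb).1⟩
      · intro x hx
        rw [hD, mem_filter] at hx
        obtain ⟨-, ho, ha, hb⟩ := hx
        exact (coinPair_flips hn3 hR cv (Ne.symm f2) hab x ho ha hb).2
    · /- κ CONSTANT -/
      push Not at hκ
      have hconst := kap_const_of_forall A hκ
      set q₀ : Fin n := ⟨0, by omega⟩ with hq₀
      by_cases hk0 : kap A q₀ = 0
      · have hκ0 : ∀ i, kap A i = 0 := fun i => (hconst i q₀).trans hk0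
        by_cases he : ∃ s, eps A cv s = 1
        · /- (4c) κ ≡ 0, some e_s = 1: creation at s -/
          obtain ⟨s, hs⟩ := he
          exact hcreate s true (by rw [hs, hκ0, hκ0]; decide)
        · /- (4d) κ ≡ 0, e ≡ 0: the NULL family never wins -/
          push Not at he
          have h01 : ∀ w : ZMod 2, w ≠ 1 → w = 0 := by decide
          have he0 : ∀ s, eps A cv s = 0 := fun s => h01 _ (he s)
          refine Or.inl (card_eq_zero.2 (filter_eq_empty_iff.2 fun x _ hx => ?_))
          obtain ⟨ho, hr⟩ := hx
          rw [rel_affine_iff hn3 A cv x ho, wval_null hn3 hR cv hκ0 he0 (kline_inKernel hn3 x ho)] at hr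
          exact zero_ne_one hr
      · /- (4b) κ ≡ 1: creation at q₀ with the fifth value matched to e -/
        have h10 : ∀ w : ZMod 2, w ≠ 0 → w = 1 := by decide
        have hκ1 : ∀ i, kap A i = 1 := fun i => (hconst i q₀).trans (h10 _ hk0)
        have hb : ∀ w : ZMod 2, w + 1 + bitVal (decide (w = 1)) * 1 = 1 := by decide
        exact hcreate q₀ (decide (eps A cv q₀ = 1)) (by rw [hκ1, hκ1]; exact hb _)

/-- **RUNG `AffineStakesHardOdd3` — PROVED unconditionally** (`hardcoreCylinderLB`). -/
theorem affineStakesHardOdd3 : AffineStakesHardOdd3 := affineStakesHardOdd3_of hardcoreCylinderLB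

end Summit.QuantumAdvantage.AdviceFreeQNC0.Fib19
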